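import Summits.SmoothPoincare4.SmoothPoincare4.Theses.CylinderEntropy
import Summits.SmoothPoincare4.SmoothPoincare4.Theorems.CylinderEntropyCylinderRungTwoKillingFluxDefs
import Summits.SmoothPoincare4.SmoothPoincare4.Theorems.CylinderEntropySliceCalibration
import Summits.SmoothPoincare4.SmoothPoincare4.Theorems.ThinCrossSectionExists.Negative.FrameAnalysis
import Literature.Geometry.Manifold.CylinderSlice
import Literature.Geometry.Riemannian.SphericalCylinderEntropy
import Literature.Topology.FourManifolds.CerfGammaFourProofs
import HarnessLib

/-!
# Route `CylinderEntropy`, crux `CylinderRungTwo` (stmt-SmoothPoincare4-7631), line `killing-flux`: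
# the crux implies the finite-time half (registered helper `helper_finiteTimeHalfOfCylinderRungTwo`)

The lead's stub `stub_finiteTimeHalf` of the checked skeleton
`Cruxes/CylinderRungTwo/Lines/killing_flux.lean` (the finite-time half: every thin homotopy-4-sphere
cross-section `ι : M → N = S⁴ × ℝ ⊂ ℝ⁶` carries an immortal smooth thin cylinder flow OF `M` in its slab)
is crux-equivalent.  The skeleton composes `FiniteTimeHalf` with the analytic stubs into the crux; this
file is the converse direction as an unconditional tree theorem:

  `CylinderRungTwo → FiniteTimeHalf` (spelled out in the vocabulary of
  `Theorems/CylinderEntropyCylinderRungTwoKillingFluxDefs.lean`).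

Proof.  The crux turns the thin cross-section `ι` into a diffeomorphism `d : M ≃ₘ S⁴`; the STATIC slice
`sliceMap c ∘ d` at the height `c = (ι y₀)₅` of a point of `ι(M)`, with the constant upward unit normal
`e₅`, is a cylinder flow of `M` (`isCylinderMCF_staticSlice_comp`: every clause of `IsCylinderMCF`,
slices being minimal), it separates the ends, stays in the slab of `ι`, and it is THIN:

* **vertical translation invariance of the typed functional** (`cylEntropy_image_add_smul_axis`):
  `λ_cyl(A + c e₅) = λ_cyl(A)` for every `A ⊆ ℝ⁶`, because the typed kernel satisfies
  `K_{p + c e₅, τ}(z + c e₅) = K_{p,τ}(z)` (it depends on `⟨z', p'⟩` and `z₅ - p₅` only), `μH⁴` is invariant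
  under the isometry `z ↦ z + c e₅` (`IsometryEquiv.measurePreserving_hausdorffMeasure`), and
  `p ∈ N ↔ p + c e₅ ∈ N`;
* `range (sliceMap c) = range (sliceMap 0) + c e₅` and `range (sliceMap 0) = S⁴ × {0}`, whose typed
  entropy is `≤ 1` by the LANDED calibration `cylEntropy_slice₀_le_one`
  (`Theorems/CylinderEntropySliceCalibration.lean`, item stmt-SmoothPoincare4-7634);
* `1 < 4/e` (`e < 2.72`; landed as `ThinCrossSectionExists.Negative.one_lt_level`).

Everything is PROVED (no `sorry`, no definitions, no named facts); the transport lemmas of the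
skeleton's `LeadStub` section are re-proved here with the sphere written in full.
-/

noncomputable section

-- the prescribed namespace `Summit.SmoothPoincare4.SmoothPoincare4.…` repeats `SmoothPoincare4`
set_option linter.dupNamespace false

open MeasureTheory Set
open scoped Manifold ContDiff ENNReal Topology BigOperators ContinuousMap RealInnerProductSpace Gradient

namespace Summit.SmoothPoincare4.SmoothPoincare4.Cruxes.CylinderRungTwo.KillingFlux

open Literature.Geometry.Riemannian
open Literature.Geometry.Lorentzian Literature.Geometry.Lorentzian.PseudoRiemannianMetric
open Literature.Geometry.Riemannian.SphericalCylinderEntropy (cylKernel cylDensity cylEntropy cylKernel_eq)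
open Literature.Geometry.Manifold.CylinderSlice
open Summit.SmoothPoincare4.SmoothPoincare4.Theorems (cylEntropy_slice₀_le_one)

namespace FiniteTimeHalfOfCrux

/-! ## Vertical translation invariance of the typed cylinder entropy -/

/-- The base coordinates of the axis vector `e₅` vanish. [folklore] -/
theorem axis_apply_castSucc (i : Fin 5) : (axis : EuclideanSpace ℝ (Fin 6)) (Fin.castSucc i) = 0 := by
  simp [axis, castSucc_ne_five i]

/-- The height of the axis vector `e₅` is `1`. [folklore] -/
theorem axis_apply_five : (axis : EuclideanSpace ℝ (Fin 6)) 5 = 1 := by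
  simp [axis]

/-- A vertical translation does not move the base coordinates. [folklore] -/
theorem add_smul_axis_apply_castSucc (z : EuclideanSpace ℝ (Fin 6)) (c : ℝ) (i : Fin 5) :
    (z + c • axis) (Fin.castSucc i) = z (Fin.castSucc i) := by
  simp [axis_apply_castSucc]

/-- A vertical translation by `c e₅` adds `c` to the height. [folklore] -/
theorem add_smul_axis_apply_five (z : EuclideanSpace ℝ (Fin 6)) (c : ℝ) :
    (z + c • axis) 5 = z 5 + c := by
  simp [axis_apply_five]

/-- Vertical translations preserve membership in the cylinder `N`. [folklore] -/
theorem sum_sq_add_smul_axis (p : EuclideanSpace ℝ (Fin 6)) (c : ℝ) :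
    ∑ i : Fin 5, (p + c • axis) (Fin.castSucc i) ^ 2 = ∑ i : Fin 5, p (Fin.castSucc i) ^ 2 := by
  simp only [add_smul_axis_apply_castSucc]

/-- **The typed kernel is invariant under simultaneous vertical translation of centre and argument**:
`K_{p + c e₅, τ}(z + c e₅) = K_{p, τ}(z)` (it depends on `⟨z', p'⟩` and on `z₅ - p₅` only). [folklore] -/
theorem cylKernel_add_smul_axis (p : EuclideanSpace ℝ (Fin 6)) (τ c : ℝ) (z : EuclideanSpace ℝ (Fin 6)) :
    cylKernel (p + c • axis) τ (z + c • axis) = cylKernel p τ z := by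
  rw [cylKernel_eq, cylKernel_eq]
  simp only [add_smul_axis_apply_castSucc, add_smul_axis_apply_five]
  rw [show z 5 + c - (p 5 + c) = z 5 - p 5 by ring]

/-- **`μH⁴` is invariant under translations of `ℝ⁶`** (set-integral form, no measurability needed):
`∫⁻ z in A + v, G z dμH⁴ = ∫⁻ z in A, G (z + v) dμH⁴`. [folklore] -/
theorem setLIntegral_image_add_right (v : EuclideanSpace ℝ (Fin 6))
    (G : EuclideanSpace ℝ (Fin 6) → ℝ≥0∞) (A : Set (EuclideanSpace ℝ (Fin 6))) :
    ∫⁻ z in (fun z => z + v) '' A, G z ∂μH[4] = ∫⁻ z in A, G (z + v) ∂μH[4] :=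
  (((IsometryEquiv.addRight v).measurePreserving_hausdorffMeasure 4).setLIntegral_comp_emb
    (IsometryEquiv.addRight v).toHomeomorph.measurableEmbedding G A).symm

/-- **The typed density is invariant under vertical translations**:
`F̂_{p + c e₅, τ}(A + c e₅) = F̂_{p, τ}(A)`. [folklore] -/
theorem cylDensity_image_add_smul_axis (A : Set (EuclideanSpace ℝ (Fin 6)))
    (p : EuclideanSpace ℝ (Fin 6)) (τ c : ℝ) :
    cylDensity ((fun z => z + c • axis) '' A) (p + c • axis) τ = cylDensity A p τ := by
  unfold cylDensity
  rw [setLIntegral_image_add_right]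
  simp only [cylKernel_add_smul_axis]

/-- `λ_cyl(A + c e₅) ≤ λ_cyl(A)`: every centre `p ∈ N` of the left supremum is `(p - c e₅) + c e₅` with
`p - c e₅ ∈ N`. [folklore] -/
theorem cylEntropy_image_add_smul_axis_le (A : Set (EuclideanSpace ℝ (Fin 6))) (c : ℝ) :
    cylEntropy ((fun z => z + c • axis) '' A) ≤ cylEntropy A := by
  refine iSup₂_le fun p hp => iSup₂_le fun τ hτ => ?_
  have hp' : ∑ i : Fin 5, (p + (-c) • axis) (Fin.castSucc i) ^ 2 = 1 := by
    rw [sum_sq_add_smul_axis]; exact hp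
  have hpc : p + (-c) • axis + c • axis = p := by
    rw [add_assoc, ← add_smul, neg_add_cancel, zero_smul, add_zero]
  have key : cylDensity ((fun z => z + c • axis) '' A) p τ = cylDensity A (p + (-c) • axis) τ := by
    have h := cylDensity_image_add_smul_axis A (p + (-c) • axis) τ c
    rwa [hpc] at h
  rw [key]
  exact le_iSup_of_le (p + (-c) • axis) (le_iSup_of_le hp' (le_iSup_of_le τ (le_iSup_of_le hτ le_rfl)))

/-- **Vertical translation invariance of the typed cylinder entropy**: `λ_cyl(A + c e₅) = λ_cyl(A)`
for every `A ⊆ ℝ⁶` and `c : ℝ`. [folklore] -/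
theorem cylEntropy_image_add_smul_axis (A : Set (EuclideanSpace ℝ (Fin 6))) (c : ℝ) :
    cylEntropy ((fun z => z + c • axis) '' A) = cylEntropy A := by
  refine le_antisymm (cylEntropy_image_add_smul_axis_le A c) ?_
  have h := cylEntropy_image_add_smul_axis_le ((fun z => z + c • axis) '' A) (-c)
  have hid : (fun z : EuclideanSpace ℝ (Fin 6) => z + c • axis + (-c) • axis) = id := by
    funext z
    simp only [id_eq, add_assoc, ← add_smul, add_neg_cancel, zero_smul, add_zero]
  rwa [Set.image_image, hid, Set.image_id] at h

/-! ## Slices are thin -/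

/-- The slice at height `c` is the vertical translate of the slice at height `0`. [folklore] -/
theorem range_sliceMap_eq_image (c : ℝ) :
    Set.range (sliceMap c) = (fun z => z + c • axis) '' Set.range (sliceMap 0) := by
  rw [← Set.range_comp]
  congr 1
  funext x
  simp [sliceMap]

/-- **Every slice is calibrated from above**: `λ_cyl(S⁴ × {c}) ≤ 1` (translation invariance + the
landed `SliceCalibration`, `cylEntropy_slice₀_le_one`). [folklore] -/
theorem cylEntropy_range_sliceMap_le_one (c : ℝ) : cylEntropy (Set.range (sliceMap c)) ≤ 1 := by
  rw [range_sliceMap_eq_image, cylEntropy_image_add_smul_axis, range_sliceMap]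
  exact cylEntropy_slice₀_le_one

/-- **Slices are thin**: `λ_cyl(S⁴ × {c}) < 4/e` for every height `c` (`λ_cyl ≤ 1` and `1 < 4/e`, the
latter being the landed `ThinCrossSectionExists.Negative.one_lt_level`). [folklore] -/
theorem cylEntropy_range_sliceMap_lt (c : ℝ) :
    cylEntropy (Set.range (sliceMap c)) < ENNReal.ofReal (4 / Real.exp 1) :=
  (cylEntropy_range_sliceMap_le_one c).trans_lt
    Summit.SmoothPoincare4.SmoothPoincare4.Theorems.ThinCrossSectionExists.Negative.one_lt_level

/-! ## The static slice transported along a diffeomorphism `M ≃ₘ S⁴` -/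

/-- Chain rule for the transported slice embedding: `d(sliceMap c ∘ d)_y = d(sliceMap c)_{d y} ∘ dd_y`.
[folklore] -/
theorem mfderiv_sliceMap_comp' (c : ℝ) {M : Type} [TopologicalSpace M]
    [ChartedSpace (EuclideanSpace ℝ (Fin 4)) M] [IsManifold (𝓡 4) ∞ M]
    (d : M ≃ₘ⟮𝓡 4, 𝓡 4⟯ Metric.sphere (0 : EuclideanSpace ℝ (Fin 5)) 1) (y : M) :
    mfderiv (𝓡 4) (𝓡 6) (sliceMap c ∘ d) y =
      (mfderiv (𝓡 4) (𝓡 6) (sliceMap c) (d y)).comp (mfderiv (𝓡 4) (𝓡 4) d y) := by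
  haveI : Fact (Module.finrank ℝ (EuclideanSpace ℝ (Fin 5)) = 4 + 1) := ⟨finrank_euclideanSpace_fin⟩
  have h1 : MDifferentiableAt (𝓡 4) (𝓡 6) (sliceMap c) (d y) :=
    ((contMDiff_sliceMap c (m := ∞)) (d y)).mdifferentiableAt (by simp)
  have h2 : MDifferentiableAt (𝓡 4) (𝓡 4) d y := (d.contMDiff y).mdifferentiableAt (by simp)
  exact mfderiv_comp y h1 h2

/-- The differential of a diffeomorphism kills no non-zero vector. [folklore] -/
theorem mfderiv_diffeomorph_ne_zero' {M : Type} [TopologicalSpace M]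
    [ChartedSpace (EuclideanSpace ℝ (Fin 4)) M] [IsManifold (𝓡 4) ∞ M]
    (d : M ≃ₘ⟮𝓡 4, 𝓡 4⟯ Metric.sphere (0 : EuclideanSpace ℝ (Fin 5)) 1) (y : M)
    {v : TangentSpace (𝓡 4) y} (hv : v ≠ 0) : mfderiv (𝓡 4) (𝓡 4) d y v ≠ 0 := by
  haveI : Fact (Module.finrank ℝ (EuclideanSpace ℝ (Fin 5)) = 4 + 1) := ⟨finrank_euclideanSpace_fin⟩
  intro h
  have hinj : Function.Injective (d.mfderivToContinuousLinearEquiv (by simp) y) :=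
    (d.mfderivToContinuousLinearEquiv (by simp) y).injective
  have h' : ((d.mfderivToContinuousLinearEquiv (by simp) y :
      TangentSpace (𝓡 4) y →L[ℝ] TangentSpace (𝓡 4) (d y))) v = 0 := by
    rw [Diffeomorph.mfderivToContinuousLinearEquiv_coe]; exact h
  refine hv (hinj ?_)
  rw [map_zero]
  exact h'

/-- The transported slice embedding `sliceMap c ∘ d` is a (spacelike =) immersion for the Euclidean
metric. [folklore] -/
theorem isSpacelikeImmersion_sliceMap_comp' (c : ℝ) {M : Type} [TopologicalSpace M]
    [ChartedSpace (EuclideanSpace ℝ (Fin 4)) M] [IsManifold (𝓡 4) ∞ M]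
    (d : M ≃ₘ⟮𝓡 4, 𝓡 4⟯ Metric.sphere (0 : EuclideanSpace ℝ (Fin 5)) 1) :
    (euclideanMetric (EuclideanSpace ℝ (Fin 6))).IsSpacelikeImmersion (𝓡 4) (sliceMap c ∘ d) := by
  haveI : Fact (Module.finrank ℝ (EuclideanSpace ℝ (Fin 5)) = 4 + 1) := ⟨finrank_euclideanSpace_fin⟩
  refine ⟨(contMDiff_sliceMap c).comp d.contMDiff, fun y v hv => ?_⟩
  have hne := mfderiv_diffeomorph_ne_zero' d y hv
  have hpos := (isSpacelikeImmersion_sliceMap c).inducedBilin_pos (d y) hne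
  rw [inducedBilin_apply] at hpos ⊢
  rw [mfderiv_sliceMap_comp']
  exact hpos

/-- **Transported slices are minimal**: the mean curvature of `sliceMap c ∘ d` with respect to `e₅`
vanishes for every diffeomorphism `d : M ≃ₘ S⁴` (the image lies in a level set of the LINEAR height,
whose Hessian is zero; tree formula `meanCurvature_unitGradient_eq_sum`). [folklore] -/
theorem meanCurvature_sliceMap_comp' (c : ℝ) {M : Type} [TopologicalSpace M]
    [ChartedSpace (EuclideanSpace ℝ (Fin 4)) M] [IsManifold (𝓡 4) ∞ M]
    (d : M ≃ₘ⟮𝓡 4, 𝓡 4⟯ Metric.sphere (0 : EuclideanSpace ℝ (Fin 5)) 1)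
    (hf : (euclideanMetric (EuclideanSpace ℝ (Fin 6))).IsSpacelikeImmersion (𝓡 4) (sliceMap c ∘ d))
    (y : M) :
    (euclideanMetric (EuclideanSpace ℝ (Fin 6))).meanCurvature (sliceMap c ∘ d)
      contMDiff_pullbackBilin_holds hf (fun _ => axis) y = 0 := by
  haveI : Fact (Module.finrank ℝ (EuclideanSpace ℝ (Fin 5)) = 4 + 1) := ⟨finrank_euclideanSpace_fin⟩
  have hFl : ContDiff ℝ ∞ (heightL : EuclideanSpace ℝ (Fin 6) → ℝ) := heightL.contDiff
  have hy : (𝓡 4).IsInteriorPoint y := BoundarylessManifold.isInteriorPoint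
  have hx : ∇ (heightL : EuclideanSpace ℝ (Fin 6) → ℝ) ((sliceMap c ∘ d) y) ≠ 0 := by
    rw [gradient_heightL]
    simp [axis]
  have hdF : ∀ w : TangentSpace (𝓡 4) y,
      fderiv ℝ (heightL : EuclideanSpace ℝ (Fin 6) → ℝ) ((sliceMap c ∘ d) y)
        (mfderiv (𝓡 4) 𝓘(ℝ, EuclideanSpace ℝ (Fin 6)) (sliceMap c ∘ d) y w) = 0 := by
    intro w
    rw [ContinuousLinearMap.fderiv]
    have h : mfderiv (𝓡 4) 𝓘(ℝ, EuclideanSpace ℝ (Fin 6)) (sliceMap c ∘ d) y w =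
        mfderiv (𝓡 4) (𝓡 6) (sliceMap c) (d y) (mfderiv (𝓡 4) (𝓡 4) d y w) :=
      DFunLike.congr_fun (mfderiv_sliceMap_comp' c d y) w
    rw [h]
    exact heightL_mvfderiv_sliceMap c (d y) _
  have hν : (fun z : M => (unitGradient (heightL : EuclideanSpace ℝ (Fin 6) → ℝ) ((sliceMap c ∘ d) z) :
      EuclideanSpace ℝ (Fin 6))) = fun _ => axis := by
    funext z
    exact unitGradient_heightL _
  obtain ⟨b, -, -, hH⟩ := meanCurvature_unitGradient_eq_sum (W := EuclideanSpace ℝ (Fin 6)) (I' := 𝓡 4)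
    hFl contMDiff_pullbackBilin_holds hf hy hx hdF (finrank_euclideanSpace_fin (𝕜 := ℝ) (n := 4))
  rw [hν] at hH
  rw [hH]
  have hfd : fderiv ℝ (heightL : EuclideanSpace ℝ (Fin 6) → ℝ) = fun _ => heightL := by
    funext z
    exact ContinuousLinearMap.fderiv heightL
  refine mul_eq_zero_of_right _ (Finset.sum_eq_zero fun i _ => ?_)
  rw [iteratedFDeriv_two_apply, hfd, fderiv_fun_const]
  rfl

/-- **The static slice flow transported along a diffeomorphism `d : M ≃ₘ S⁴` is a cylinder flow of
`M`** (every clause of `IsCylinderMCF`, as for the landed `isCylinderMCF_staticSlice`). [folklore] -/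
theorem isCylinderMCF_staticSlice_comp' (c T : ℝ) {M : Type} [TopologicalSpace M]
    [ChartedSpace (EuclideanSpace ℝ (Fin 4)) M] [IsManifold (𝓡 4) ∞ M]
    (d : M ≃ₘ⟮𝓡 4, 𝓡 4⟯ Metric.sphere (0 : EuclideanSpace ℝ (Fin 5)) 1) :
    IsCylinderMCF M (fun _ => sliceMap c ∘ d) (fun _ _ => axis) T where
  contMDiffOn := by
    haveI : Fact (Module.finrank ℝ (EuclideanSpace ℝ (Fin 5)) = 4 + 1) := ⟨finrank_euclideanSpace_fin⟩
    exact ⟨Set.univ, isOpen_univ, Set.subset_univ _,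
      (((contMDiff_sliceMap c).comp d.contMDiff).comp contMDiff_snd).contMDiffOn⟩
  isSmoothEmbedding _ _ := by
    haveI : Fact (Module.finrank ℝ (EuclideanSpace ℝ (Fin 5)) = 4 + 1) := ⟨finrank_euclideanSpace_fin⟩
    exact (isSmoothEmbedding_sliceMap c).comp_diffeomorph d
  mem_cyl _ _ x := sum_sq_sliceMap c (d x)
  isSpacelikeImmersion _ _ := isSpacelikeImmersion_sliceMap_comp' c d
  isUnitNormal _ _ := by
    haveI : Fact (Module.finrank ℝ (EuclideanSpace ℝ (Fin 5)) = 4 + 1) := ⟨finrank_euclideanSpace_fin⟩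
    refine ⟨fun y v => ?_, fun y => ?_⟩
    · rw [euclideanMetric_apply]
      have h : mfderiv (𝓡 4) 𝓘(ℝ, EuclideanSpace ℝ (Fin 6)) (sliceMap c ∘ d) y v =
          mfderiv (𝓡 4) (𝓡 6) (sliceMap c) (d y) (mfderiv (𝓡 4) (𝓡 4) d y v) :=
        DFunLike.congr_fun (mfderiv_sliceMap_comp' c d y) v
      change heightL (mfderiv (𝓡 4) 𝓘(ℝ, EuclideanSpace ℝ (Fin 6)) (sliceMap c ∘ d) y v) = 0
      rw [h]
      exact heightL_mvfderiv_sliceMap c (d y) _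
    · rw [euclideanMetric_apply]
      change ⟪axis, axis⟫ = (1 : ℝ)
      simp [axis]
  normal_tangent _ _ x := by simp [axis, castSucc_ne_five]
  contMDiff_normal _ _ := contMDiff_const
  velocity_eq t _ x := by
    rw [meanCurvature_sliceMap_comp', neg_zero, zero_smul]
    show mfderiv 𝓘(ℝ, ℝ) (𝓡 6) (fun _ : ℝ => (sliceMap c ∘ d) x) t 1 = 0
    rw [mfderiv_const]
    rfl

/-- The height of a transported slice is the constant `c`. [folklore] -/
theorem sliceMap_comp_apply_five' (c : ℝ) {M : Type}
    (d : M → Metric.sphere (0 : EuclideanSpace ℝ (Fin 5)) 1) (x : M) :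
    (sliceMap c ∘ d) x 5 = c :=
  sliceMap_apply_last c (d x)

end FiniteTimeHalfOfCrux

open FiniteTimeHalfOfCrux

/-- **Registered helper `helper_finiteTimeHalfOfCylinderRungTwo`: the crux implies the lead's stub
`stub_finiteTimeHalf`** (one half of "`stub_finiteTimeHalf` is crux-equivalent").  If `CylinderRungTwo`
holds, then every thin homotopy-4-sphere cross-section `ι : M → N` (smooth embedding into
`N = S⁴ × ℝ ⊂ ℝ⁶` separating the ends with `λ_cyl(range ι) < 4/e`) carries an immortal smooth cylinder
flow OF `M` — the STATIC slice at the height `(ι y₀)₅` of a point of `ι(M)`, transported along the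
diffeomorphism `d : M ≃ₘ S⁴` provided by the crux, with the upward unit normal `e₅` — which separates
the ends (it contains a whole slice), is thin at all times (`λ_cyl(S⁴ × {c}) ≤ 1 < 4/e`: vertical
translation invariance of the typed functional + the landed calibration `λ_cyl(S⁴ × {0}) ≤ 1`), and
stays in the slab `[(ι y₀)₅ - 1, (ι y₀)₅ + 1]`.  Together with the skeleton's sorry-free composition
(`FiniteTimeHalf` + analytic stubs ⇒ crux) this is the kernel-checked evidence that the promoted stub is
crux-sized. [folklore] -/
theorem helper_finiteTimeHalfOfCylinderRungTwo : Summit.SmoothPoincare4.SmoothPoincare4.Theses.CylinderEntropy.CylinderRungTwo → ∀ (M : Type) [TopologicalSpace M] [T2Space M] [SecondCountableTopology M] [ChartedSpace (EuclideanSpace ℝ (Fin 4)) M] [IsManifold (𝓡 4) ∞ M], M ≃ₕ Metric.sphere (0 : EuclideanSpace ℝ (Fin 5)) 1 → ∀ ι : M → EuclideanSpace ℝ (Fin 6), Manifold.IsSmoothEmbedding (𝓡 4) (𝓡 6) ∞ ι → (∀ x, ∑ i : Fin 5, ι x (Fin.castSucc i) ^ 2 = 1) → SeparatesEnds (Set.range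 ι) → cylEntropy (Set.range ι) < ENNReal.ofReal (4 / Real.exp 1) → ∃ (F : ℝ → M → EuclideanSpace ℝ (Fin 6)) (ν : ℝ → M → EuclideanSpace ℝ (Fin 6)) (T : ℝ), IsCylinderMCF M F ν T ∧ (∀ t, T ≤ t → SeparatesEnds (Set.range (F t))) ∧ (∀ t, T ≤ t → cylEntropy (Set.range (F t)) < ENNReal.ofReal (4 / Real.exp 1)) ∧ (∀ t, T ≤ t → ∀ x, ∃ y y' : M, ι y 5 - 1 ≤ F t x 5 ∧ F t x 5 ≤ ι y' 5 + 1) := by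
  haveI : Fact (Module.finrank ℝ (EuclideanSpace ℝ (Fin 5)) = 4 + 1) := ⟨finrank_euclideanSpace_fin⟩
  intro hR M _ _ _ _ _ e ι hι hN hsep hent
  obtain ⟨d⟩ := hR M e ι hι hN hsep hent
  -- `M` is non-empty (it is homotopy equivalent to the non-empty `S⁴`)
  have y₀ : M := e.invFun ⟨EuclideanSpace.single 0 1, by simp⟩
  have hrange : Set.range (sliceMap (ι y₀ 5) ∘ d) = Set.range (sliceMap (ι y₀ 5)) := by
    rw [Set.range_comp, EquivLike.range_eq_univ d, Set.image_univ]
  refine ⟨fun _ => sliceMap (ι y₀ 5) ∘ d, fun _ _ => axis, 0, isCylinderMCF_staticSlice_comp' (ι y₀ 5) 0 d,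
    fun t _ => ?_, fun t _ => ?_, fun t _ x => ⟨y₀, y₀, ?_, ?_⟩⟩
  · show SeparatesEnds (Set.range (sliceMap (ι y₀ 5) ∘ d))
    rw [hrange]
    exact separatesEnds_of_slice_subset (by rw [range_sliceMap])
  · show cylEntropy (Set.range (sliceMap (ι y₀ 5) ∘ d)) < ENNReal.ofReal (4 / Real.exp 1)
    rw [hrange]
    exact cylEntropy_range_sliceMap_lt (ι y₀ 5)
  · show ι y₀ 5 - 1 ≤ (sliceMap (ι y₀ 5) ∘ d) x 5
    rw [sliceMap_comp_apply_five']
    linarith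
  · show (sliceMap (ι y₀ 5) ∘ d) x 5 ≤ ι y₀ 5 + 1
    rw [sliceMap_comp_apply_five']
    linarith

end Summit.SmoothPoincare4.SmoothPoincare4.Cruxes.CylinderRungTwo.KillingFlux

end
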